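import Summits.FinalStateConjecture.FinalStateConjecture.Statement
import Literature.Geometry.Lorentzian.CoordScalarCurvatureEvolution
import HarnessLib

/-!
# Crux `SettledCapture` (stmt-FinalStateConjecture-17328), line `null-concave-crush`:
# the VOCABULARY of the line (route-posited objects, moved verbatim out of the skeleton)

Route `BartnikGapSettling`; crux `Summit.FinalStateConjecture.FinalStateConjecture.Theses.BartnikGapSettling.SettledCapture`
(rank 4); line skeleton `Cruxes/SettledCapture/Lines/null_concave_crush.lean`
(planner-cruxplan-stmt-FinalStateConjecture-17328-null-concave-crush-0; lead a1). The skeleton's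
four coordinate-level definitions are moved here VERBATIM (same names, same bodies, same
docstrings) so that the registered stubs `stub_kerrCrushCertificate`, `stub_crushTransport`,
`stub_exteriorCaptureWithInteriorCharts` — whose signatures mention them — can be landed as
`Theorems/` modules (`--supports stmt-FinalStateConjecture-17328`):

* `interiorBackground` — the horizon-penetrating boosted ingoing-Kerr–Schild `ModelBackground`
  with inner radius `r₀` (the crux's own star charts are the case `r₀ = M`; the line uses
  `r₀ = r₋(M, a)`, charting Boyer–Lindquist blocks I ∪ II);
* `lateShell` — the open late shell `{T < t, r₁ < r < r₂}` of a model background;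
* `KerrCrushCertificate` — the weighted null-concave crush certificate WITH MARGIN for exact Kerr
  (`C²` radial profile `F > 0` on `[r₁, r₂]`; slope `d(F∘r)(w) ≤ −m‖w‖` on future null `w`;
  weighted concavity `F · Hess(F∘r)(w,w) − ρ (d(F∘r) w)² ≤ −m‖w‖²` on null `w`, `Hess` the
  coordinate Hessian `MetricCoord.hessAt` of the Kerr–Schild components `Kerr.bilin M a`);
* `IsGoodInteriorChart` — `η`-goodness of an interior chart of a development on a late shell
  (smooth, open embedding into `J⁺(Σ)`, future-oriented, `C¹`-deviation `≤ η`).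

Nothing here is a statement; the stub statements and the composition `SettledCapture_of` stay in
the skeleton. The Riccati core these feed is `exit_of_weightedConcave` /
`false_of_pos_of_deriv_neg_of_weightedConcave` (`BartnikGapSettlingSettledCaptureExitOfWeightedConcave.lean`).
References: Dafermos–Rodnianski arXiv:0811.0354 §5.1 (ingoing Kerr–Schild / Kerr-star charts);
Dafermos–Luk arXiv:1710.01722 (red-shift / no-shift regions of the Kerr interior); O'Neill 1983,
Ch. 3, Lemma 3.49 (Hessian). [cite: arXiv08110354, §5.1] [cite: DafermosLuk2017] [cite: ONeill1983, Ch. 3, Lemma 3.49]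
-/

noncomputable section

-- D-0017: single-problem summit, `Summit.<S>.<S>.…` by design (cf. lakefile `weak.linter.dupNamespace`).
set_option linter.dupNamespace false

namespace Summit.FinalStateConjecture.FinalStateConjecture.Theorems.BartnikGapSettling.SettledCapture

open Set Filter Function TopologicalSpace
open scoped Manifold ContDiff Topology ENNReal
open Literature.Geometry.Lorentzian

/-- The **horizon-penetrating boosted Kerr–Schild background with inner radius `r₀`**: domain
`{x | Λ⁻¹(x − c) ∈ Kerr.region a r₀} = {r > max r₀ 0}` in the rest frame, form `boostedKerrBilin`, time the rest-frame
ingoing Kerr–Schild time `t*`, radius the rest-frame Kerr–Schild `r` (the crux's own star charts are the case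
`r₀ = M`; here `r₀ = r₋(M, a)` charts Boyer–Lindquist blocks I ∪ II, `CH⁺` lying at `t* = +∞`).
Dafermos–Rodnianski arXiv:0811.0354, §5.1 (ingoing Kerr–Schild coordinates cover the interior).
[cite: arXiv08110354, §5.1] -/
def interiorBackground (mo : lorentzGroup × E4) (M a r₀ : ℝ) : ModelBackground :=
  ⟨⟨poincareInv mo.1 mo.2 ⁻¹' (Kerr.region a r₀ : Set E4),
      (Kerr.region a r₀).isOpen.preimage (continuous_poincareInv mo.1 mo.2)⟩,
    boostedKerrBilin mo.1 mo.2 M a, fun x => poincareInv mo.1 mo.2 x 0,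
    fun x => Kerr.radius a (poincareInv mo.1 mo.2 x)⟩

/-- The **open late shell** `{T < t, r₁ < r < r₂}` of a model background (chart time after `T`, chart radius strictly
between `r₁` and `r₂`). [folklore] -/
def lateShell (B : ModelBackground) (T r₁ r₂ : ℝ) : Set B.domain :=
  {x | T < B.time x.1 ∧ r₁ < B.radius x.1 ∧ B.radius x.1 < r₂}

/-- Membership in the late shell. [folklore] -/
@[simp]
theorem mem_lateShell {B : ModelBackground} {T r₁ r₂ : ℝ} {x : B.domain} :
    x ∈ lateShell B T r₁ r₂ ↔ T < B.time x.1 ∧ r₁ < B.radius x.1 ∧ B.radius x.1 < r₂ :=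
  Iff.rfl

/-- The late shell lies in the late region `{T < t}` of the background. [folklore] -/
theorem lateShell_subset_lateRegion (B : ModelBackground) (T r₁ r₂ : ℝ) :
    lateShell B T r₁ r₂ ⊆ B.lateRegion T := fun _ hx ↦ hx.1

/-- The late shells are antitone in the time `T` and monotone in the radial window. [folklore] -/
theorem lateShell_mono (B : ModelBackground) {T T' r₁ r₁' r₂ r₂' : ℝ} (hT : T ≤ T') (h₁ : r₁ ≤ r₁')
    (h₂ : r₂' ≤ r₂) : lateShell B T' r₁' r₂' ⊆ lateShell B T r₁ r₂ := fun _ hx ↦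
  ⟨hT.trans_lt hx.1, h₁.trans_lt hx.2.1, hx.2.2.trans_le h₂⟩

/-- **Weighted null-concave crush certificate with margin** for exact Kerr `(M, a)` in ingoing Kerr–Schild
coordinates, radial profile `F`, weight `ρ`, margin `m`, on the closed shell `{r₁ ≤ r ≤ r₂}`: `F` is `C²` and
positive on `[r₁, r₂]`, and for every `g_{M,a}`-null coordinate vector `w` at a shell point `x`, with
`f := F ∘ r`: (slope) `df_x(w) ≤ −m‖w‖` whenever `w` is future-directed (`g(w, V) < 0`, `V = Kerr.timeVector` the
future timelike field `−g♯dt*`), and (weighted concavity) `f(x) · Hess f_x(w, w) − ρ · df_x(w)² ≤ −m‖w‖²`, `Hess`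
the coordinate Hessian `MetricCoord.hessAt` of the components `Kerr.bilin M a` (`= ∇²f` of the Levi-Civita
connection). Homogeneous of degree 1 resp. 2 in `w`, so it is a condition on the compact bundle of normalised null
directions over the shell modulo `∂_{t*}, ∂_φ`; the ratio form `f Hess f(w,w)/df(w)² ≤ ρ̄ < ρ` of the crux idea card
`null-concave-crush` gives it. Route-posited object (crux `SettledCapture`, line `null-concave-crush`). [folklore] -/
def KerrCrushCertificate (M a r₁ r₂ ρ m : ℝ) (F : ℝ → ℝ) : Prop :=
  ContDiff ℝ 2 F ∧ (∀ r ∈ Icc r₁ r₂, 0 < F r) ∧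
    ∀ x : E4, r₁ ≤ Kerr.radius a x → Kerr.radius a x ≤ r₂ → ∀ w : E4, Kerr.bilin M a x w w = 0 →
      (Kerr.bilin M a x w (Kerr.timeVector M a x) < 0 →
          fderiv ℝ (F ∘ Kerr.radius a) x w ≤ -(m * ‖w‖)) ∧
        F (Kerr.radius a x) * MetricCoord.hessAt (Kerr.bilin M a) (F ∘ Kerr.radius a) x w w -
            ρ * fderiv ℝ (F ∘ Kerr.radius a) x w ^ 2 ≤ -(m * ‖w‖ ^ 2)

section Chart

variable {X : Type} [TopologicalSpace X] [ChartedSpace E3 X] [IsManifold (𝓡 3) ((⊤ : ℕ∞) : WithTop ℕ∞) X]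
  [ConnectedSpace X] {D : InitialDataSet (𝓡 3) X}

/-- The interior chart `Φ` of the development `𝒟` from the boosted ingoing-Kerr background `(M, a)`, motion `mo`,
inner radius `r₋(M, a)`, is **`η`-good on the late shell `{T < t*, r₁ < r < r₂}`**: smooth there, an open embedding of
the shell into `J⁺(Σ)`, FUTURE-ORIENTED (the push-forward of the boosted Kerr future timelike field `Λ V_{M,a}` is
future-directed for `𝒟`), and `C¹`-CLOSE: the `C¹` sup norm over the shell of the coordinate deviation
`Φ^* g − g_{M,a,Λ,c}` (`Spacetime.deviationExtend`, `supCkENorm … 1`) is at most `η`. The shape of the interior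
export of Dafermos–Luk (red-shift + no-shift regions of the Kerr interior, `CH⁺` at `t* = +∞` never charted).
Route-posited object (crux `SettledCapture`, line `null-concave-crush`). [cite: DafermosLuk2017] -/
def IsGoodInteriorChart (𝒟 : VacuumCauchyDevelopment D) (mo : lorentzGroup × E4) (M a : ℝ)
    (Φ : (interiorBackground mo M a (Kerr.rMinus M a)).domain → 𝒟.carrier) (T r₁ r₂ : ℝ) (η : ℝ≥0∞) : Prop :=
  ContMDiffOn 𝓘(ℝ, E4) (𝓡 4) ((⊤ : ℕ∞) : WithTop ℕ∞) Φ
      (lateShell (interiorBackground mo M a (Kerr.rMinus M a)) T r₁ r₂) ∧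
    Topology.IsOpenEmbedding ((lateShell (interiorBackground mo M a (Kerr.rMinus M a)) T r₁ r₂).restrict Φ) ∧
    Φ '' lateShell (interiorBackground mo M a (Kerr.rMinus M a)) T r₁ r₂ ⊆
      𝒟.metric.causalFuture 𝒟.timeOrientation (range 𝒟.embed) ∧
    (∀ x ∈ lateShell (interiorBackground mo M a (Kerr.rMinus M a)) T r₁ r₂,
      𝒟.timeOrientation.IsFutureDirected (mfderiv 𝓘(ℝ, E4) (𝓡 4) Φ x
        ((mo.1 : E4 ≃L[ℝ] E4) (Kerr.timeVector M a (poincareInv mo.1 mo.2 (x : E4)))))) ∧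
    supCkENorm (Subtype.val '' lateShell (interiorBackground mo M a (Kerr.rMinus M a)) T r₁ r₂) 1
        (𝒟.toSpacetime.deviationExtend (interiorBackground mo M a (Kerr.rMinus M a)) Φ) ≤ η

end Chart

/-- **The late shells of the interior backgrounds are open** (registered sub-goal
`stub_isOpen_lateShell_interiorBackground` of crux `SettledCapture`, line `null-concave-crush`; the vocabulary
carrier of the line): the chart time `x ↦ (Λ⁻¹(x − c))⁰` and the chart radius `x ↦ r(a, Λ⁻¹(x − c))` are continuous
on `E4` (`continuous_poincareInv`, `Kerr.continuous_radius`), so `{T < t*, r₁ < r < r₂}` is open in the (open)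
domain. Used by the transport and interior-export stubs to differentiate the metric deviation on the shell. [folklore] -/
theorem stub_isOpen_lateShell_interiorBackground : ∀ (mo : lorentzGroup × E4) (M a r₀ T r₁ r₂ : ℝ), IsOpen (lateShell (interiorBackground mo M a r₀) T r₁ r₂) := by
  intro mo M a r₀ T r₁ r₂
  have ht : Continuous fun x : (interiorBackground mo M a r₀).domain ↦
      (interiorBackground mo M a r₀).time x.1 := by
    change Continuous fun x : (interiorBackground mo M a r₀).domain ↦ poincareInv mo.1 mo.2 x.1 0
    exact ((EuclideanSpace.proj (0 : Fin 4)).continuous.comp (continuous_poincareInv mo.1 mo.2)).comp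
      continuous_subtype_val
  have hr : Continuous fun x : (interiorBackground mo M a r₀).domain ↦
      (interiorBackground mo M a r₀).radius x.1 := by
    change Continuous fun x : (interiorBackground mo M a r₀).domain ↦
      Kerr.radius a (poincareInv mo.1 mo.2 x.1)
    exact ((Kerr.continuous_radius a).comp (continuous_poincareInv mo.1 mo.2)).comp continuous_subtype_val
  exact (isOpen_lt continuous_const ht).inter
    ((isOpen_lt continuous_const hr).inter (isOpen_lt hr continuous_const))

end Summit.FinalStateConjecture.FinalStateConjecture.Theorems.BartnikGapSettling.SettledCapture

end
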